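import Literature.MathematicalPhysics.KineticTheory.InfiniteChainSpecificationDensity
import HarnessLib

/-!
# Boundary locality and measurability of the chain's finite-volume Gibbs distributions

Topic `Literature/MathematicalPhysics/KineticTheory`; theorems only (no definitions, no named
facts). Sequel of `InfiniteChainSpecificationDensity.lean` (the kernels
`γ_Λ(· | η) = chainSpecification P T Λ η` of the oscillator chain as ratios of marginal integrals
`(∫⋯∫⁻_Λ 𝟙_A e^{-H_Λ/T})(η) / (∫⋯∫⁻_Λ e^{-H_Λ/T})(η)`).

* `dependsOn_hamiltonianIn_chain` — `H_Λ` (LLL (10)) reads the configuration only on the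
  neighbourhood `Λ ∪ (Λ - 1) ∪ (Λ + 1)` (sites of `Λ` and endpoints of the bonds meeting `Λ`);
* `dependsOn_lmarginal` (general form of the tree's `dependsOn_lmarginal_compl`): integrating out
  `s` from an observable reading `t` leaves an observable reading `t \ s`;
* `dependsOn_lmarginal_boltzmannWeight` — the normaliser `Z_Λ(η) = (∫⋯∫⁻_Λ e^{-H_Λ/T})(η)`
  reads `η` only on the outer boundary `(Λ - 1) ∪ (Λ + 1) \ Λ`;
* `measurable_chainSpecification_apply` — `η ↦ γ_Λ(A | η)` is measurable for the product
  σ-algebra (Georgii's axiom (ii) in its weak form, as needed for `∫ γ_Λ(A | η) dμ(η)`);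
* `dependsOn_chainSpecification_apply` — **properness/locality in the boundary condition**:
  `γ_Λ(A | η)` depends on `η` only off `Λ`, and for an event `A` read on `t` only on
  `(t ∪ (Λ - 1) ∪ (Λ + 1)) \ Λ` (`dependsOn_chainSpecification_apply_of_dependsOn`) — for a cylinder
  event over a window `W ⊇ Λ ± 1`, only on `W \ Λ` (Georgii 2011, (1.21)–(1.23): `γ_Λ(A | ·)` is
  `𝓕_{Λᶜ}`-measurable, and `𝓣_Λ`-local for local `A` and finite-range interactions).

## References

* H.-O. Georgii, *Gibbs Measures and Phase Transitions*, 2nd ed. (2011), Def. 1.23, §1.2, Def. 2.9.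
  [Georgii2011]
* O. E. Lanford, J. L. Lebowitz, E. H. Lieb, J. Stat. Phys. 16 (1977), §2 (10), §4 (14).
  [LanfordLebowitzLieb1977]
-/

noncomputable section

open MeasureTheory Filter Set Function Literature.Probability.LatticeModels
open scoped ENNReal

namespace Literature.MathematicalPhysics.KineticTheory.HeatConduction

/-! ### Marginal integrals and `DependsOn` -/

/-- **Integrating out `s` leaves an observable reading only `t \ s`** (if the integrand read only
`t`; general form of `dependsOn_lmarginal_compl`) (Georgii 2011, §1.2). [cite: Georgii2011, §1.2] -/
theorem dependsOn_lmarginal {δ : Type*} {X : δ → Type*} [∀ i, MeasurableSpace (X i)]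
    {μ : ∀ i, Measure (X i)} [DecidableEq δ] (s : Finset δ) {t : Set δ}
    {F : (∀ i, X i) → ℝ≥0∞} (hF : DependsOn F t) :
    DependsOn (∫⋯∫⁻_s, F ∂μ) (t \ (↑s : Set δ)) := by
  intro x x' hxx'
  unfold lmarginal
  refine lintegral_congr fun y => hF fun i hi => ?_
  by_cases his : i ∈ s
  · rw [Function.updateFinset_def, Function.updateFinset_def]
    simp only [dif_pos his]
  · rw [Function.updateFinset_def, Function.updateFinset_def]
    simp only [dif_neg his]
    exact hxx' i ⟨hi, his⟩

namespace OscillatorChain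

variable (P : OscillatorChain)

/-! ### Locality of the Hamiltonian and of the Boltzmann weight -/

/-- **`H_Λ` reads the configuration only on `Λ ∪ (Λ - 1) ∪ (Λ + 1)`** (sites of `Λ` and the
endpoints `y, y + 1`, `y ∈ bondSet Λ = Λ ∪ (Λ - 1)`, of the bonds meeting `Λ`; LLL (10)).
[cite: LanfordLebowitzLieb1977, §2 eq. (10)] -/
theorem dependsOn_hamiltonianIn_chain (Λ : Finset ℤ) :
    DependsOn (fun σ : ChainConfig => hamiltonianIn P.chainPotential chainSupp Λ σ)
      (↑(Λ ∪ bondSet Λ ∪ (bondSet Λ).image (· + 1)) : Set ℤ) := by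
  intro σ σ' h
  simp only [Finset.coe_union, Finset.coe_image, mem_union, Finset.mem_coe, mem_image] at h
  simp only [hamiltonianIn_chain]
  congr 1
  · refine Finset.sum_congr rfl fun x hx => ?_
    rw [h x (Or.inl (Or.inl hx))]
  · refine Finset.sum_congr rfl fun y hy => ?_
    rw [h y (Or.inl (Or.inr hy)), h (y + 1) (Or.inr ⟨y, hy, rfl⟩)]

/-- The Boltzmann weight `e^{-H_Λ/T}` reads the configuration only on `Λ ∪ (Λ - 1) ∪ (Λ + 1)`.
[cite: LanfordLebowitzLieb1977, §2 eq. (10)] -/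
theorem dependsOn_boltzmannWeight (T : ℝ) (Λ : Finset ℤ) :
    DependsOn (fun σ : ChainConfig =>
      ENNReal.ofReal (Real.exp (-T⁻¹ * hamiltonianIn P.chainPotential chainSupp Λ σ)))
      (↑(Λ ∪ bondSet Λ ∪ (bondSet Λ).image (· + 1)) : Set ℤ) :=
  fun σ σ' h => by
    have hH := P.dependsOn_hamiltonianIn_chain Λ h
    simp only at hH ⊢
    rw [hH]

/-- **The normaliser `Z_Λ(η)` reads the boundary condition only on the outer boundary**
`(Λ ∪ (Λ - 1) ∪ (Λ + 1)) \ Λ` (finite range). [cite: Georgii2011, Def. 2.9] -/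
theorem dependsOn_lmarginal_boltzmannWeight (T : ℝ) (Λ : Finset ℤ) :
    DependsOn (∫⋯∫⁻_Λ, (fun σ : ChainConfig =>
        ENNReal.ofReal (Real.exp (-T⁻¹ * hamiltonianIn P.chainPotential chainSupp Λ σ)))
      ∂fun _ : ℤ => (volume : Measure (ℝ × ℝ)))
      ((↑(Λ ∪ bondSet Λ ∪ (bondSet Λ).image (· + 1)) : Set ℤ) \ (↑Λ : Set ℤ)) :=
  dependsOn_lmarginal Λ (P.dependsOn_boltzmannWeight T Λ)

/-! ### Measurability and locality of the kernels in the boundary condition -/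

/-- **`η ↦ γ_Λ(A | η)` is measurable** (product σ-algebra) for measurable `U`, `V` and `A`: both
marginal integrals in `chainSpecification_apply_eq_lmarginal_div` are measurable in the frozen
coordinates (Mathlib `Measurable.lmarginal`) (Georgii 2011, Def. 1.23 (ii), weak form).
[cite: Georgii2011, Def. 1.23] -/
theorem measurable_chainSpecification_apply (hU : Measurable P.U) (hV : Measurable P.V) (T : ℝ)
    (Λ : Finset ℤ) {A : Set ChainConfig} (hA : MeasurableSet A) :
    Measurable fun η : ChainConfig => P.chainSpecification T Λ η A := by
  have hw := P.measurable_boltzmannWeight hU hV T Λ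
  have h1 : Measurable (∫⋯∫⁻_Λ, (fun σ : ChainConfig => A.indicator 1 σ *
      ENNReal.ofReal (Real.exp (-T⁻¹ * hamiltonianIn P.chainPotential chainSupp Λ σ)))
      ∂fun _ : ℤ => (volume : Measure (ℝ × ℝ))) :=
    ((measurable_one.indicator hA).mul hw).lmarginal _
  have h2 : Measurable (∫⋯∫⁻_Λ, (fun σ : ChainConfig =>
      ENNReal.ofReal (Real.exp (-T⁻¹ * hamiltonianIn P.chainPotential chainSupp Λ σ)))
      ∂fun _ : ℤ => (volume : Measure (ℝ × ℝ))) :=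
    hw.lmarginal _
  have heq : (fun η : ChainConfig => P.chainSpecification T Λ η A) = fun η =>
      (∫⋯∫⁻_Λ, (fun σ : ChainConfig => A.indicator 1 σ *
          ENNReal.ofReal (Real.exp (-T⁻¹ * hamiltonianIn P.chainPotential chainSupp Λ σ)))
        ∂fun _ : ℤ => (volume : Measure (ℝ × ℝ))) η /
      (∫⋯∫⁻_Λ, (fun σ : ChainConfig =>
          ENNReal.ofReal (Real.exp (-T⁻¹ * hamiltonianIn P.chainPotential chainSupp Λ σ)))
        ∂fun _ : ℤ => (volume : Measure (ℝ × ℝ))) η :=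
    funext fun η => P.chainSpecification_apply_eq_lmarginal_div hU hV T Λ η hA
  rw [heq]
  exact h1.div h2

/-- **`γ_Λ(A | η)` depends on the boundary condition only off `Λ`** (measurable `U`, `V`, `A`)
(Georgii 2011, Def. 1.23 (ii): `γ_Λ(A | ·)` is `𝓕_{Λᶜ}`-measurable). [cite: Georgii2011, Def. 1.23] -/
theorem dependsOn_chainSpecification_apply (hU : Measurable P.U) (hV : Measurable P.V) (T : ℝ)
    (Λ : Finset ℤ) {A : Set ChainConfig} (hA : MeasurableSet A) :
    DependsOn (fun η : ChainConfig => P.chainSpecification T Λ η A) ((↑Λ : Set ℤ)ᶜ) := by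
  intro η η' h
  simp only
  rw [P.chainSpecification_apply_eq_lmarginal_div hU hV T Λ η hA,
    P.chainSpecification_apply_eq_lmarginal_div hU hV T Λ η' hA,
    lmarginal_congr _ _ (fun i hi => h i (by simpa using hi)),
    lmarginal_congr (fun _ : ℤ => (volume : Measure (ℝ × ℝ))) (fun σ : ChainConfig =>
      ENNReal.ofReal (Real.exp (-T⁻¹ * hamiltonianIn P.chainPotential chainSupp Λ σ)))
      (fun i hi => h i (by simpa using hi))]

/-- **Locality of `γ_Λ(A | η)` for local events**: if the event `A` is read on `t`
(`DependsOn 𝟙_A t`), then `γ_Λ(A | η)` depends on `η` only on `(t ∪ Λ ∪ (Λ - 1) ∪ (Λ + 1)) \ Λ`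
— for a cylinder event over a window `W ⊇ Λ ∪ (Λ ± 1)`, only on `W \ Λ` (finite range; Georgii
2011, (2.15)–(2.16) and Def. 2.9). [cite: Georgii2011, Def. 2.9] -/
theorem dependsOn_chainSpecification_apply_of_dependsOn (hU : Measurable P.U) (hV : Measurable P.V)
    (T : ℝ) (Λ : Finset ℤ) {A : Set ChainConfig} (hA : MeasurableSet A) {t : Set ℤ}
    (ht : DependsOn (A.indicator (1 : ChainConfig → ℝ≥0∞)) t) :
    DependsOn (fun η : ChainConfig => P.chainSpecification T Λ η A)
      ((t ∪ (↑(Λ ∪ bondSet Λ ∪ (bondSet Λ).image (· + 1)) : Set ℤ)) \ (↑Λ : Set ℤ)) := by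
  -- the numerator reads `t ∪ neighbourhood`, the denominator the neighbourhood
  have hnum : DependsOn (fun σ : ChainConfig => A.indicator 1 σ *
      ENNReal.ofReal (Real.exp (-T⁻¹ * hamiltonianIn P.chainPotential chainSupp Λ σ)))
      (t ∪ (↑(Λ ∪ bondSet Λ ∪ (bondSet Λ).image (· + 1)) : Set ℤ)) := by
    intro σ σ' h
    have hH := P.dependsOn_hamiltonianIn_chain Λ fun i hi => h i (Or.inr hi)
    simp only at hH ⊢
    rw [ht fun i hi => h i (Or.inl hi), hH]
  have hden : DependsOn (fun σ : ChainConfig =>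
      ENNReal.ofReal (Real.exp (-T⁻¹ * hamiltonianIn P.chainPotential chainSupp Λ σ)))
      (t ∪ (↑(Λ ∪ bondSet Λ ∪ (bondSet Λ).image (· + 1)) : Set ℤ)) :=
    (P.dependsOn_boltzmannWeight T Λ).mono subset_union_right
  have h1 := dependsOn_lmarginal (μ := fun _ : ℤ => (volume : Measure (ℝ × ℝ))) Λ hnum
  have h2 := dependsOn_lmarginal (μ := fun _ : ℤ => (volume : Measure (ℝ × ℝ))) Λ hden
  intro η η' h
  simp only
  rw [P.chainSpecification_apply_eq_lmarginal_div hU hV T Λ η hA,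
    P.chainSpecification_apply_eq_lmarginal_div hU hV T Λ η' hA, h1 h, h2 h]

end OscillatorChain

end Literature.MathematicalPhysics.KineticTheory.HeatConduction
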